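import Literature.AnabelianGeometry.AbsoluteAnabelian.AbsAnabLemma114Holds
import Literature.AnabelianGeometry.AbsoluteAnabelian.AbsAnabStarConditionSplitCompletion
import Literature.AnabelianGeometry.AbsoluteAnabelian.NFGaloisTFGNormalCorollaries
import Literature.AnabelianGeometry.AbsoluteAnabelian.AbsTopIProp23GFGAffineModelExtension
import Literature.AnabelianGeometry.AbsoluteAnabelian.AbsTopIProp23InfiniteIndexProofs
import Literature.AnabelianGeometry.AbsoluteAnabelian.FundamentalExtensionRestrictionStarDescent
import Literature.AnabelianGeometry.AbsoluteAnabelian.FundamentalExtensionRestrictionMLFBase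
import Literature.AnabelianGeometry.AbsoluteAnabelian.FundamentalExtensionRestrictionGeomDescent
import HarnessLib

/-!
# [AbsAnab] Lemma 1.1.4 vocabulary at the genuine carriers of the tree (L-F rows F-0001, F-0005, F-0012)

S. Mochizuki, *The Absolute Anabelian Geometry of Hyperbolic Curves* (2004) [AbsAnab], Lemma 1.1.4
(A. Tamagawa), manuscript pp. 7–8 (lit key `paper:url-e8f118cc205e`).  PROOF-ONLY companion (no
definition, no named fact) for the D-0079 L-F census of the [AbsAnab] §1.1 rows of
`plan/L4/LF-ABSTOP.tsv` whose instances AT THE GENUINE CARRIERS of the tree were missing as named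
declarations:

* **F-0005 `GeomIsMaxTFGNormalIn`** (Lemma 1.1.4 (i): "`Δ ∩ Π′` is the unique maximal closed normal
  subgroup of `Π′` which is topologically finitely generated", `G = G_F`, `F` a number field).  The tree
  proves it for EVERY extension with NF base data and `Δ` tfg (`geomIsMaxTFGNormalIn_of_nfBase`, over
  [AbsAnab] Thm 1.1.2 = `galoisNF_tfgNormalSubgroup_trivial_holds`); here it is instantiated at the
  [AbsTopI] Def 2.1 (i) GFG construction of `Δ` (proper `Γ ≅ S_g`, affine free `Γ`, and `Γ_{g,k+1}`), where
  `Δ` tfg is the theorem `prop22_prop23_gfg_*_nf` — ZERO residual hypotheses beyond the construction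
  data: `NFBase.geomIsMaxTFGNormalIn_gfg`, `_gfg_affine`, `_gfg_puncturedSurfaceGroup`.
  NEGATIVE complement (the number-field base is load-bearing): at EVERY extension with MLF base data,
  `Δ` tfg and `G` tfg (the latter a theorem for `G ≅ G_K`, `K/ℚ_p` finite — [NSW] Thm 7.5.10, filed
  Summits-side as `isTopologicallyFinitelyGenerated_absoluteGaloisGroup_padic`, carried here as the
  binder `hG` because Literature cannot import Summits), the predicate FAILS at every open `Π′`
  (`MLFBase.not_geomIsMaxTFGNormalIn_of_tfg`): `Π′` itself is a tfg closed normal subgroup of `Π′` not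
  contained in `Δ` (else `[Π : Δ] < ∞`, contradicting `MLFBase.not_finiteIndex_geom`).  In particular
  the MLF-base consumers of `GeomIsMaxTFGNormalIn ⊤` (e.g. `thm214GroupPart_of_geomIsMaxTFGNormalIn`)
  have hypotheses that are not jointly satisfiable with `G_K` tfg — INFO for the L-F book; the
  non-vacuous Thm 2.14 (i) closers are `thm214GroupPart_of_starCondition` / `_of_coinvariantRankConstant`.
* **F-0001 `CoinvariantRankConstant`** (the p. 8 step "`δ¹_l(Π′) − δ¹_l(G′)` independent of `l`").  The
  tree proves it for EVERY extension with MLF base data modulo splitting + (∗)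
  (`coinvariantRankConstant_of_mlfBase`, no finite-generation hypothesis on `G`).  Here: (a) the split
  model `Γ̂ × G_K ↠ G_K` (`Γ̂` a pro-`𝔓𝔯𝔦𝔪𝔢𝔰` completion of any finitely generated `Γ`, `K/ℚ_p` finite)
  UNCONDITIONALLY — `coinvariantRankConstant_split_of_isProSigmaCompletion_mlf`,
  `coinvariantRankConstant_split_profiniteCompletion_freeGroup_mlf` (the tree's `…_of_tfg` forms carry a
  binder `hG` that the MLF-base route does not need); (b) DESCENT to every open subgroup `U ⊆ Π`
  (`MLFBase.coinvariantRankConstant_ofOpenSubgroup`, over the restricted base data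
  `MLFBase.ofOpenSubgroup` and the descent of splitting and (∗)).
* **F-0012 `StarCondition`** ((∗) of Lemma 1.1.4 (ii)).  Instances of record (pre-existing, cited by
  name only): split pro-`𝔓𝔯𝔦𝔪𝔢𝔰` completions over any profinite `G` (`starCondition_split_of_isProSigmaCompletion`),
  the cyclotomic model `ℤ_ℓ(1) ⋊_χ G_K` (`AbsTopIThm26vCyclotomicInstance`), `Δ` free procyclic central,
  `Δ = 1`, and descent `starCondition_ofOpenSubgroup`.  HONEST LABEL: at the GFG construction with MLF
  base the tree discharges `Δ` tfg but NOT (∗) — (∗) depends on the extension class (in print it is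
  [AbsAnab] Lemma 1.1.5, Tate modules of semi-abelian varieties, applied to `Δ^{ab}` of a curve); no
  `Π_X` of a hyperbolic curve over an MLF is constructed in the tree (E-list), so (∗) stays an explicit
  binder `hstar` wherever a GFG-carrier statement needs it — nothing here asserts it.

HONEST FRAMING: classical, refereed lemma; model/instance level as labelled; OUR kernel check; nothing
here bears on [IUTchIII] Cor. 3.12 or takes a side; typed ≠ proved elsewhere.
-/

noncomputable section

open Topology Field

namespace Literature.AnabelianGeometry.AbsoluteAnabelian

namespace FundamentalExtension

open Literature.AnabelianGeometry.SemiGraphs.PSCDatum (IsMaxProSigmaQuotient)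
open Literature.AnabelianGeometry.SemiGraphs.SemiGraphOfAnabelioids
open Literature.AnabelianGeometry.SemiGraphs.SemiGraphOfAnabelioids (IsProSigmaCompletion)
open Literature.GroupTheory.CombinatorialGroupTheory
open Literature.Topology.FourManifolds (SurfaceGroup)
open Literature.IUT.HodgeTheaters (profiniteCompletion toCompletion)

/-! ### F-0005 at the GFG construction, NF base: zero residual -/

section GFGProper

variable {E : FundamentalExtension.{0}} {Sigma Sigma' : Set ℕ} {Γ : Type} [Group Γ]
  {P : Type} [Group P] [TopologicalSpace P] [IsTopologicalGroup P] [CompactSpace P]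
  [TotallyDisconnectedSpace P] {j : Γ →* P} {π : P →* E.geom} {U : Subgroup P}

/-- **[AbsAnab] Lemma 1.1.4 (i) at the [AbsTopI] Def 2.1 (i) GFG construction (proper case), NF base,
UNCONDITIONAL**: for an extension `1 → Δ → Π → G → 1` with `G ≅ G_F` (`F` a number field) whose `Δ` is the
Def 2.1 (i) quotient of a pro-`Σ′` completion of `Γ ≅ S_g` (`g ≥ 2`), and every open `Π′ ⊆ Π`, `Δ ∩ Π′`
is the unique maximal topologically finitely generated closed normal subgroup of `Π′` (`Δ` tfg by
`prop22_prop23_gfg_nf`, then `geomIsMaxTFGNormalIn_of_nfBase`). [cite: MochizukiAbsAnab2004, Lemma 1.1.4 (i) p.7] -/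
theorem NFBase.geomIsMaxTFGNormalIn_gfg (B : E.NFBase) (hSS : Sigma ⊆ Sigma')
    (hS : ∃ ℓ ∈ Sigma, ℓ.Prime) (hSp : ∀ p ∈ Sigma, p.Prime) {g : ℕ} (hg : 2 ≤ g)
    (e : Γ ≃* SurfaceGroup g) (hj : IsProSigmaCompletion Sigma' j) [U.Normal]
    (hUo : IsOpen (U : Set P)) (hπc : Continuous π) (hπs : Function.Surjective π) (hker : π.ker ≤ U)
    (hmax : IsMaxProSigmaQuotient Sigma (π.subgroupMap U))
    (Q : Subgroup E.arith) (hQ : IsOpen (Q : Set E.arith)) : E.GeomIsMaxTFGNormalIn Q :=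
  E.geomIsMaxTFGNormalIn_of_nfBase B (prop22_prop23_gfg_nf B hSS hS hSp hg e hj hUo hπc hπs hker hmax).1
    Q hQ

end GFGProper

section GFGAffine

variable {E : FundamentalExtension.{0}} {Sigma Sigma' : Set ℕ} {Γ : Type} [Group Γ] [IsFreeGroup Γ]
  [Finite (IsFreeGroup.Generators Γ)]
  {P : Type} [Group P] [TopologicalSpace P] [IsTopologicalGroup P] [CompactSpace P]
  [TotallyDisconnectedSpace P] {j : Γ →* P} {π : P →* E.geom} {U : Subgroup P}

/-- **[AbsAnab] Lemma 1.1.4 (i) at the affine GFG construction (`Γ` free of rank `≥ 2`), NF base,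
UNCONDITIONAL.** [cite: MochizukiAbsAnab2004, Lemma 1.1.4 (i) p.7] -/
theorem NFBase.geomIsMaxTFGNormalIn_gfg_affine (B : E.NFBase)
    (hn : 2 ≤ Nat.card (IsFreeGroup.Generators Γ)) (hSS : Sigma ⊆ Sigma')
    (hS : ∃ ℓ ∈ Sigma, ℓ.Prime) (hSp : ∀ p ∈ Sigma, p.Prime) (hj : IsProSigmaCompletion Sigma' j)
    [U.Normal] (hUo : IsOpen (U : Set P)) (hπc : Continuous π) (hπs : Function.Surjective π)
    (hker : π.ker ≤ U) (hmax : IsMaxProSigmaQuotient Sigma (π.subgroupMap U))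
    (Q : Subgroup E.arith) (hQ : IsOpen (Q : Set E.arith)) : E.GeomIsMaxTFGNormalIn Q :=
  E.geomIsMaxTFGNormalIn_of_nfBase B
    (prop22_prop23_gfg_affine_nf B hn hSS hS hSp hj hUo hπc hπs hker hmax).1 Q hQ

end GFGAffine

section GFGPunctured

variable {E : FundamentalExtension.{0}} {Sigma Sigma' : Set ℕ} {g k : ℕ}
  {P : Type} [Group P] [TopologicalSpace P] [IsTopologicalGroup P] [CompactSpace P]
  [TotallyDisconnectedSpace P] {j : PuncturedSurfaceGroup g (k + 1) →* P} {π : P →* E.geom}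
  {U : Subgroup P}

/-- **[AbsAnab] Lemma 1.1.4 (i) at the GFG construction over `Γ_{g,k+1}` (hyperbolic affine type), NF
base, UNCONDITIONAL.** [cite: MochizukiAbsAnab2004, Lemma 1.1.4 (i) p.7] -/
theorem NFBase.geomIsMaxTFGNormalIn_gfg_puncturedSurfaceGroup (B : E.NFBase)
    (hgk : PuncturedSurfaceGroup.IsHyperbolicType g (k + 1)) (hSS : Sigma ⊆ Sigma')
    (hS : ∃ ℓ ∈ Sigma, ℓ.Prime) (hSp : ∀ p ∈ Sigma, p.Prime) (hj : IsProSigmaCompletion Sigma' j)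
    [U.Normal] (hUo : IsOpen (U : Set P)) (hπc : Continuous π) (hπs : Function.Surjective π)
    (hker : π.ker ≤ U) (hmax : IsMaxProSigmaQuotient Sigma (π.subgroupMap U))
    (Q : Subgroup E.arith) (hQ : IsOpen (Q : Set E.arith)) : E.GeomIsMaxTFGNormalIn Q :=
  E.geomIsMaxTFGNormalIn_of_nfBase B
    (prop22_prop23_gfg_puncturedSurfaceGroup_nf B hgk hSS hS hSp hj hUo hπc hπs hker hmax).1 Q hQ

end GFGPunctured

/-! ### F-0005 at MLF base data: the predicate fails (the NF hypothesis is load-bearing) -/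

section MLFNegative

variable {E : FundamentalExtension.{0}}

/-- **At an MLF base, `GeomIsMaxTFGNormalIn Π′` FAILS for every open `Π′ ⊆ Π`** as soon as `Δ` and `G`
are topologically finitely generated (`G ≅ G_K` IS tfg — [NSW] Thm 7.5.10, Summits-side theorem
`isTopologicallyFinitelyGenerated_absoluteGaloisGroup_padic` — carried as the binder `hG`): `Π′` is then
a tfg closed normal subgroup of itself, so maximality would force `Π′ ⊆ Δ`, i.e. `[Π : Δ] < ∞`, which
contradicts `G_K` infinite (`MLFBase.not_finiteIndex_geom`).  [AbsAnab] Lemma 1.1.4 (i) is stated for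
`G = G_F` only; this is the kernel form of "the number field is essential".
[cite: MochizukiAbsAnab2004, Lemma 1.1.4 (i) p.7] -/
theorem MLFBase.not_geomIsMaxTFGNormalIn_of_tfg (B : E.MLFBase) (hΔ : E.GeomTFG)
    (hG : IsTopologicallyFinitelyGenerated E.gal) (Q : Subgroup E.arith)
    (hQ : IsOpen (Q : Set E.arith)) : ¬ E.GeomIsMaxTFGNormalIn Q := by
  intro h
  have hPi : IsTopologicallyFinitelyGenerated E.arith :=
    IsTopologicallyFinitelyGenerated.of_extension E.aug E.aug_surjective hΔ hG
  have hQtfg : IsTopologicallyFinitelyGenerated Q := hPi.subgroup_isOpen Q hQ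
  have hnorm : (Q.subgroupOf Q).Normal := by
    rw [Subgroup.subgroupOf_self]
    infer_instance
  have hle : Q ≤ E.geom ⊓ Q := h.2 Q le_rfl hnorm (Q.isClosed_of_isOpen hQ) hQtfg
  have hQΔ : Q ≤ E.geom := fun x hx => (hle hx).1
  haveI : Finite (E.arith ⧸ Q) := Subgroup.quotient_finite_of_isOpen Q hQ
  haveI : Q.FiniteIndex := Subgroup.finiteIndex_of_finite_quotient
  exact B.not_finiteIndex_geom (Subgroup.finiteIndex_of_le hQΔ)

/-- In particular **`GeomIsMaxTFGNormalIn ⊤` fails at every MLF-base extension with `G` tfg** (no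
hypothesis on `Δ`: its finite generation is the first conjunct of the predicate at `Π′ = Π`) — so the
MLF-base consumers of this hypothesis shape are vacuous once `G_K` tfg is supplied; the non-vacuous
[AbsTopI] Thm 2.14 (i) / [AbsTopII] Rmk 3.3.2 closers over MLF bases are the `StarCondition` /
`CoinvariantRankConstant` / `Thm26v` ones. [cite: MochizukiAbsAnab2004, Lemma 1.1.4 (i) p.7] -/
theorem MLFBase.not_geomIsMaxTFGNormalIn_top_of_tfg (B : E.MLFBase)
    (hG : IsTopologicallyFinitelyGenerated E.gal) : ¬ E.GeomIsMaxTFGNormalIn ⊤ := by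
  intro h
  refine B.not_geomIsMaxTFGNormalIn_of_tfg ?_ hG ⊤ (by rw [Subgroup.coe_top]; exact isOpen_univ) h
  -- `Δ ∩ Π = Δ`, bicontinuously
  let e : ↥(E.geom ⊓ (⊤ : Subgroup E.arith)) ≃ₜ* E.geom :=
    { MulEquiv.subgroupCongr (inf_top_eq E.geom) with
      continuous_toFun := by
        apply Continuous.subtype_mk
        exact continuous_subtype_val
      continuous_invFun := by
        apply Continuous.subtype_mk
        exact continuous_subtype_val }
  exact h.1.of_continuousMulEquiv e

end MLFNegative

/-! ### F-0001 at the split model with MLF base, UNCONDITIONAL, and its descent to open subgroups -/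

section SplitMLF

/-- **F-0001 — `CoinvariantRankConstant` at the split model `Γ̂ × G_K ↠ G_K`, UNCONDITIONAL**: `Γ̂` a
pro-`𝔓𝔯𝔦𝔪𝔢𝔰` completion of any finitely generated `Γ` (e.g. `F̂_n`, `Γ̂_{g,r}`), `K` any finite extension
of `ℚ_p`; "`δ¹_l(Π″) − δ¹_l(G″)` does not depend on `l`" for every open `Π″` — splitting + (∗)
(`starCondition_split_of_isProSigmaCompletion`) fed to `coinvariantRankConstant_of_mlfBase` (the
MLF-base route through the LCFT ranks of `G″ ≅ G_{K″}`; no `hG : G tfg` binder).  HONEST LABEL: trivial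
outer action. [cite: MochizukiAbsAnab2004, proof of Lemma 1.1.4 (ii) p.8] -/
theorem coinvariantRankConstant_split_of_isProSigmaCompletion_mlf (Δ : ProfiniteGrp.{0}) {Γ : Type}
    [Group Γ] [Group.FG Γ] {ι : Γ →* Δ} (hι : IsProSigmaCompletion {q | q.Prime} ι)
    (p : ℕ) [Fact p.Prime] (K : Type) [Field K] [CharZero K] [Algebra ℚ_[p] K]
    [FiniteDimensional ℚ_[p] K] :
    (⟨ProfiniteGrp.of (Δ × absoluteGaloisGrp K), absoluteGaloisGrp K,
        ContinuousMonoidHom.snd Δ (absoluteGaloisGrp K), Prod.snd_surjective⟩ :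
      FundamentalExtension.{0}).CoinvariantRankConstant :=
  -- MLF base data of the split model: `G = G_K` on the nose
  coinvariantRankConstant_of_mlfBase _ { p := p, K := K, galIso := ContinuousMulEquiv.refl _ }
    (splitsOverOpenSubgroup_split Δ (absoluteGaloisGrp K))
    (starCondition_split_of_isProSigmaCompletion Δ (absoluteGaloisGrp K) hι)

/-- **F-0001 at `F̂_n × G_K ↠ G_K` (`F̂_n` = Mathlib's profinite completion of the free group on `n`
letters, `K/ℚ_p` finite), UNCONDITIONAL** — the `hG`-free form of
`coinvariantRankConstant_split_profiniteCompletion_freeGroup_of_tfg`.  The same statement is proved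
Summits-side as `coinvariantRankConstant_holds` (`Summits/ABC/IUTFork/AbsAnabStarSplitNonabelianInstance.lean`,
via the Summits-side finite generation of `G_K`); this is the Literature-importable twin, by the
MLF-base route instead. [cite: MochizukiAbsAnab2004, proof of Lemma 1.1.4 (ii) p.8] -/
theorem coinvariantRankConstant_split_profiniteCompletion_freeGroup_mlf (n p : ℕ) [Fact p.Prime]
    (K : Type) [Field K] [CharZero K] [Algebra ℚ_[p] K] [FiniteDimensional ℚ_[p] K] :
    (⟨ProfiniteGrp.of (profiniteCompletion (FreeGroup (Fin n)) × absoluteGaloisGroup K),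
        absoluteGaloisGrp K,
        ContinuousMonoidHom.snd (profiniteCompletion (FreeGroup (Fin n))) (absoluteGaloisGroup K),
        Prod.snd_surjective⟩ : FundamentalExtension.{0}).CoinvariantRankConstant :=
  coinvariantRankConstant_split_of_isProSigmaCompletion_mlf (profiniteCompletion (FreeGroup (Fin n)))
    (IsProSigmaCompletion.isProSigmaCompletion_toCompletion (FreeGroup (Fin n))) p K

end SplitMLF

section Descent

variable {E : FundamentalExtension.{0}}

/-- **F-0001 descends to open subgroups**: for an extension with MLF base data that splits over an open
subgroup of `G` and satisfies (∗), and every open `U ⊆ Π`, the restricted extension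
`1 → Δ ∩ U → U → aug(U) → 1` (base data `K_U`, `MLFBase.ofOpenSubgroup`) again has
`CoinvariantRankConstant` — splitting and (∗) descend (`splitsOverOpenSubgroup_ofOpenSubgroup`,
`starCondition_ofOpenSubgroup`) and the MLF-base route applies to `U`.
[cite: MochizukiAbsAnab2004, proof of Lemma 1.1.4 (ii) p.8] -/
theorem MLFBase.coinvariantRankConstant_ofOpenSubgroup (B : E.MLFBase) (hs : E.SplitsOverOpenSubgroup)
    (hstar : E.StarCondition) (U : OpenSubgroup E.arith) :
    (E.ofOpenSubgroup U).CoinvariantRankConstant :=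
  coinvariantRankConstant_of_mlfBase _ (B.ofOpenSubgroup U) (E.splitsOverOpenSubgroup_ofOpenSubgroup U hs)
    (starCondition_ofOpenSubgroup U hstar)

/-- **F-0001 at every MLF-base extension, restated next to its descent** (pre-existing route
`coinvariantRankConstant_of_mlfBase`, recorded here so that the L-F row cites one module): splitting over
an open subgroup of `G ≅ G_K` and (∗) imply `CoinvariantRankConstant`, with NO finite-generation
hypothesis on `Δ` or `G`. [cite: MochizukiAbsAnab2004, proof of Lemma 1.1.4 (ii) p.8] -/
theorem MLFBase.coinvariantRankConstant (B : E.MLFBase) (hs : E.SplitsOverOpenSubgroup)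
    (hstar : E.StarCondition) : E.CoinvariantRankConstant :=
  coinvariantRankConstant_of_mlfBase E B hs hstar

end Descent

end FundamentalExtension

end Literature.AnabelianGeometry.AbsoluteAnabelian

end
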